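import Summits.ResolutionOfSingularities.ResolutionOfSingularities.Theorems.DeepCrossCutKernels2
import HarnessLib

/-!
# DeepCrossCutKernels3 — decomp-res node «DeepCrossCut» §Y.0 RING KERNELS (lens-2 g21 rev7), file 3/3 of `DeepCrossCutKernels`

Content VERBATIM from §Y.0 (ring level) and the inhabitant kernels of the decomp-res lens-2 g21 node
`HOME/decomp-res-lens-2/g21/DeepCrossCut.lean`
(rev7, pin 607dfe85, 5 760 l; HOME = run/shared/lean/pub/decomp-res); CRITIC-LEDGER row 168 (RIDERS: the
scheme-level §Y — engines `DeepCrossExit` /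
`NodeExit`, the deep leaf, `Deep.closes`, the re-location of `Cross.CrossSpecialRung` — is HELD until the critic's
(d′) window closes and is NOT in
these files); landing orders INBOX :712 (the §Y.0 decl list) + :770 (rev7 additions `deepNewt` …
`deepCrossNewtShape_insepVV7`).  The node's
l. 132–4440 restate the earlier lens-2 nodes VERBATIM and are DELETED here (landed as `PinchCut…` / `JetCut…` /
`PurityCut…` / `SplitCut…` /
`CylinderCut…` / `SpreadCut…` / `CrossCut…`; never two copies); these ring kernels are CommRing-generic and import
only the top of the
landed lens-2 column (`SplitCutKernels2`) for the opened namespaces; the FOUR comparison lemmas with g20's `crossWt`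
/ `CrossShape`
(`deepWt_le_crossWt`, `crossWt_le_deepWt_self`, `deepCrossShape_self_iff`, `crossShape_of_deepCrossNewtShape_self`)
wait for `CrossCutLaw2` to land and
follow VERBATIM in `DeepCrossCutKernelsCross.lean` (dependency split, critic INBOX :799 «LAND NOW»).  Namespace
`…Theorems.DeepCrossCut` (the lens's `Theses.DeepCrossCut` is gate-reserved);
sections `DeepRing` ⊃ `NodeKernel`, `DeepKernel` and `InhabitantKernel`, the `variable` line, `open MvPolynomial`
and every declaration exactly as
in the lens; file split only (tree files ≤ 400 lines).  RING KERNELS ONLY: PROVED identities and monomial-ideal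
bookkeeping (0 sorry) + the two
named inhabitants INSEP-vv7 = `z² + u₁⁵ + v²u₂⁷ /𝔽₂` (chart by chart) and the nodal `N`; no scheme-level statement,
no engine, no aside, no
route edit.  All `--supports stmt-ResolutionOfSingularities-29273` (`MaxContactCut.RungOne`, the lens-2 column
root); nothing closes it.

§Y.0 ring level: THE NODE WEIGHT `nodeWt` and the node / pivot letters `NodeShape` / `PivotShape` with their chart
identities; THE DEEP-CROSS
WEIGHT `deepWt`, `DeepCrossShape`, the rev7 NEWTON MEMBER IDEAL `deepNewt` with `DeepCrossNewtShape` (⇒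
`DeepCrossShape`), the steep-pair weight `pairWt` / `SteepPairShape`,
the tower / chart identities `deep_towerOne` / `deep_vChart`; the INHABITANT KERNELS: `insepVV7_chart0…9`,
`insepVV7` / `deepFrame` /
`represent_INSEPvv7` / `deepCrossShape_insepVV7` / `deepCrossNewtShape_insepVV7` / `insepVV7_mem_sq_steep` /
`insepVV7_mem_sq_flat`, and the
nodal `nodalN` / `represent_nodalN` / `nodeShape_nodalN`.  PROVED kernels, VERBATIM (continued `…2` where the
400-line cap cuts).

Part 3/3 carries: `insepVV7_chart7`, `insepVV7_chart8`, `insepVV7_chart9`, `insepVV7`, `deepFrame`,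
`represent_INSEPvv7`, `deepCrossShape_insepVV7`, `deepCrossNewtShape_insepVV7`, `insepVV7_mem_sq_steep`,
`insepVV7_mem_sq_flat`, `nodalN`, `represent_nodalN`, `nodeShape_nodalN`.

(Sources: Hironaka1967; CossartJannsenSaito2020 Ch. 2; CossartPiltant2008 Prop. 4.2; CossartPiltant2019 Rem. 3.2;
Hauser2010Kangaroo; Moh1987.)
-/

open CategoryTheory AlgebraicGeometry TopologicalSpace IsLocalRing
open Literature.AlgebraicGeometry.Resolution
open Summit.ResolutionOfSingularities.ResolutionOfSingularities.Theorems
open Summit.ResolutionOfSingularities.ResolutionOfSingularities.Theorems.WeakOrderReduction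
open Summit.ResolutionOfSingularities.ResolutionOfSingularities.Theorems.DeltaFaceCutClasses
open Summit.ResolutionOfSingularities.ResolutionOfSingularities.Theorems.RelativeDeltaCut
open Summit.ResolutionOfSingularities.ResolutionOfSingularities.Theorems.CurveLeafExit
open Summit.ResolutionOfSingularities.ResolutionOfSingularities.Theorems.PinchCut
open Summit.ResolutionOfSingularities.ResolutionOfSingularities.Theorems.JetCut
open Summit.ResolutionOfSingularities.ResolutionOfSingularities.Theorems.PurityCut
open Summit.ResolutionOfSingularities.ResolutionOfSingularities.Theorems.SplitCut
open MvPolynomial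

namespace Summit.ResolutionOfSingularities.ResolutionOfSingularities.Theorems.DeepCrossCut

section DeepRing

variable {R : Type} [CommRing R]

section DeepKernel

/-- INSEP-vv7, final chart 7 of the greedy package (coordinates `(E7, E6, E8)`; `x = E7 * E6 ^ 2 * E8`, `y = E6`, `t
= E7 * E6 * E8 ^ 2`,
`μ = E7 * E6 ^ 4 * E8 ^ 2`): the total transform of `Z² + x⁵ + t²y⁷` is `μ² · (Z² + F_σ)` with `F_σ = E7 ^ 3 * E6 ^
2 * E8 + E6`.  KERNEL (PROVED). [folklore] -/
theorem insepVV7_chart7 (Z E7 E6 E8 : R) :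
    (Z * (E7 * E6 ^ 4 * E8 ^ 2)) ^ 2 + (E7 * E6 ^ 2 * E8) ^ 5 + (E7 * E6 * E8 ^ 2) ^ 2 * (E6) ^ 7 =
      (E7 * E6 ^ 4 * E8 ^ 2) ^ 2 * (Z ^ 2 + (E7 ^ 3 * E6 ^ 2 * E8 + E6)) := by
  ring

/-- INSEP-vv7, final chart 8 of the greedy package (coordinates `(x, E6, E7)`; `x = x * E6 ^ 2 * E7`, `y = E6`, `t = E6 * E7`,
`μ = E6 ^ 4 * E7`): the total transform of `Z² + x⁵ + t²y⁷` is `μ² · (Z² + F_σ)` with `F_σ = x ^ 5 * E6 ^ 2 * E7 ^ 3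
+ E6`.  KERNEL (PROVED). [folklore] -/
theorem insepVV7_chart8 (Z x E6 E7 : R) :
    (Z * (E6 ^ 4 * E7)) ^ 2 + (x * E6 ^ 2 * E7) ^ 5 + (E6 * E7) ^ 2 * (E6) ^ 7 =
      (E6 ^ 4 * E7) ^ 2 * (Z ^ 2 + (x ^ 5 * E6 ^ 2 * E7 ^ 3 + E6)) := by
  ring

/-- INSEP-vv7, final chart 9 of the greedy package (coordinates `(x, E3, E6)`; `x = x * E3 ^ 2 * E6 ^ 2`, `y = E3 *
E6`, `t = E6`,
`μ = E3 ^ 3 * E6 ^ 4`): the total transform of `Z² + x⁵ + t²y⁷` is `μ² · (Z² + F_σ)` with `F_σ = x ^ 5 * E3 ^ 4 * E6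
^ 2 + E3 * E6`.  KERNEL (PROVED). [folklore] -/
theorem insepVV7_chart9 (Z x E3 E6 : R) :
    (Z * (E3 ^ 3 * E6 ^ 4)) ^ 2 + (x * E3 ^ 2 * E6 ^ 2) ^ 5 + (E6) ^ 2 * (E3 * E6) ^ 7 =
      (E3 ^ 3 * E6 ^ 4) ^ 2 * (Z ^ 2 + (x ^ 5 * E3 ^ 4 * E6 ^ 2 + E3 * E6)) := by
  ring

end DeepKernel

end DeepRing

section InhabitantKernel

open MvPolynomial

/-- **THE DEEP TANGLE INHABITANT INSEP-vv7** [g21]: `z² + u₁⁵ + v²·u₂⁷ ∈ 𝔽₂[z, u₁, u₂, v]` (variables `0, 1, 2, 3` = the frame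
`(z, u₁, u₂, v)`; g20's NEXT-g21 (c′): the flat branch `C₂ = V(z, u₁, v)` carries inert depth `d = 7 > m = 5`).
DEFINITION (support, the bed).
[folklore] -/
noncomputable def insepVV7 : MvPolynomial (Fin 4) (ZMod 2) :=
  X 0 ^ 2 + X 1 ^ 5 + X 3 ^ 2 * X 2 ^ 7

/-- The coordinate frame `(z, u₁, u₂, v)` of `𝔸⁴`.  DEFINITION (support). [folklore] -/
noncomputable def deepFrame : Fin 4 → MvPolynomial (Fin 4) (ZMod 2) := ![X 0, X 1, X 2, X 3]

/-- INSEP-vv7 in deep-cross presentation: corner `z²`, `ε₁ = ε₂ = 1`, `m = 5` (`q = 2`), `d = 7`, NO tail.  KERNEL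
(PROVED). [folklore] -/
theorem represent_INSEPvv7 :
    insepVV7 = deepFrame 0 ^ 2 + 1 * deepFrame 1 ^ (2 * 2 + 1) + 1 * deepFrame 3 ^ 2 * deepFrame 2 ^ 7 + 0 := by
  simp only [insepVV7, deepFrame, Matrix.cons_val_zero, Matrix.cons_val_one, Matrix.head_cons, Matrix.cons_val_two,
    Matrix.tail_cons, Matrix.cons_val_three]
  ring

/-- **THE DEEP-CROSS LETTER HOLDS FOR INSEP-vv7 AT THE RING LEVEL** [g21; KERNEL (PROVED)]: `J = (INSEP-vv7)`, the
coordinate frame,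
`q = 2`, `d = 7`: units `1, 1`, tail `0`, the principal ideal deep for all three weights (`deep_terms_mem_deepWt`,
`5 ≤ 7`).  CERTIFICATE
of the inhabitant's letter (scheme-level clauses read by hand / by the instrument: NODE-g21 §3). [folklore] -/
theorem deepCrossShape_insepVV7 : DeepCrossShape (Ideal.span {insepVV7}) deepFrame 2 7 := by
  refine ⟨1, 1, 0, isUnit_one, isUnit_one, Ideal.zero_mem _, ?_, ?_⟩
  · rw [← represent_INSEPvv7]
    exact Ideal.subset_span rfl
  · rw [Ideal.span_singleton_le_iff_mem, represent_INSEPvv7, add_zero]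
    exact deep_terms_mem_deepWt deepFrame 1 1 2 7 (by norm_num)

/-- **THE NEWTON-TYPED DEEP-CROSS LETTER HOLDS FOR INSEP-vv7 AT THE RING LEVEL** [g21 rev7; KERNEL (PROVED)]: `J =
(INSEP-vv7)` is
principal, so `J ⊆ deepNewt` reduces to `f ∈ deepNewt` (`deep_terms_mem_deepNewt`, `5 ≤ 7`).  CERTIFICATE of the
inhabitant's letter under
the RE-TYPED member bound. [folklore] -/
theorem deepCrossNewtShape_insepVV7 : DeepCrossNewtShape (Ideal.span {insepVV7}) deepFrame 2 7 := by
  refine ⟨1, 1, 0, isUnit_one, isUnit_one, Ideal.zero_mem _, ?_, ?_⟩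
  · rw [← represent_INSEPvv7]
    exact Ideal.subset_span rfl
  · rw [Ideal.span_singleton_le_iff_mem, represent_INSEPvv7, add_zero]
    exact deep_terms_mem_deepNewt deepFrame 1 1 2 7 (by norm_num)

/-- Both branches of INSEP-vv7 lie in the order-`2` locus at the ring level: the member lies in the SQUARE of the
prime `(z, u₁, u₂)` of the
steep branch …  KERNEL (PROVED). [folklore] -/
theorem insepVV7_mem_sq_steep :
    insepVV7 ∈ (Ideal.span {deepFrame 0, deepFrame 1, deepFrame 2} : Ideal (MvPolynomial (Fin 4) (ZMod 2))) ^ 2 := by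
  rw [represent_INSEPvv7]
  have h0 : deepFrame 0 ∈ (Ideal.span {deepFrame 0, deepFrame 1, deepFrame 2} :
      Ideal (MvPolynomial (Fin 4) (ZMod 2))) := Ideal.subset_span (by simp)
  have h1 : deepFrame 1 ∈ (Ideal.span {deepFrame 0, deepFrame 1, deepFrame 2} :
      Ideal (MvPolynomial (Fin 4) (ZMod 2))) := Ideal.subset_span (by simp)
  have h2 : deepFrame 2 ∈ (Ideal.span {deepFrame 0, deepFrame 1, deepFrame 2} :
      Ideal (MvPolynomial (Fin 4) (ZMod 2))) := Ideal.subset_span (by simp)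
  refine Ideal.add_mem _ (Ideal.add_mem _ (Ideal.add_mem _ ?_ ?_) ?_) (Ideal.zero_mem _)
  · exact Ideal.pow_mem_pow h0 2
  · rw [show (1 : MvPolynomial (Fin 4) (ZMod 2)) * deepFrame 1 ^ (2 * 2 + 1) = deepFrame 1 ^ 3 * deepFrame 1 ^ 2 by ring]
    exact Ideal.mul_mem_left _ _ (Ideal.pow_mem_pow h1 2)
  · rw [show (1 : MvPolynomial (Fin 4) (ZMod 2)) * deepFrame 3 ^ 2 * deepFrame 2 ^ 7 =
        (deepFrame 3 ^ 2 * deepFrame 2 ^ 5) * deepFrame 2 ^ 2 by ring]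
    exact Ideal.mul_mem_left _ _ (Ideal.pow_mem_pow h2 2)

/-- … and in the SQUARE of the prime `(z, u₁, v)` of the flat branch.  KERNEL (PROVED). [folklore] -/
theorem insepVV7_mem_sq_flat :
    insepVV7 ∈ (Ideal.span {deepFrame 0, deepFrame 1, deepFrame 3} : Ideal (MvPolynomial (Fin 4) (ZMod 2))) ^ 2 := by
  rw [represent_INSEPvv7]
  have h0 : deepFrame 0 ∈ (Ideal.span {deepFrame 0, deepFrame 1, deepFrame 3} :
      Ideal (MvPolynomial (Fin 4) (ZMod 2))) := Ideal.subset_span (by simp)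
  have h1 : deepFrame 1 ∈ (Ideal.span {deepFrame 0, deepFrame 1, deepFrame 3} :
      Ideal (MvPolynomial (Fin 4) (ZMod 2))) := Ideal.subset_span (by simp)
  have h3 : deepFrame 3 ∈ (Ideal.span {deepFrame 0, deepFrame 1, deepFrame 3} :
      Ideal (MvPolynomial (Fin 4) (ZMod 2))) := Ideal.subset_span (by simp)
  refine Ideal.add_mem _ (Ideal.add_mem _ (Ideal.add_mem _ ?_ ?_) ?_) (Ideal.zero_mem _)
  · exact Ideal.pow_mem_pow h0 2
  · rw [show (1 : MvPolynomial (Fin 4) (ZMod 2)) * deepFrame 1 ^ (2 * 2 + 1) = deepFrame 1 ^ 3 * deepFrame 1 ^ 2 by ring]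
    exact Ideal.mul_mem_left _ _ (Ideal.pow_mem_pow h1 2)
  · rw [show (1 : MvPolynomial (Fin 4) (ZMod 2)) * deepFrame 3 ^ 2 * deepFrame 2 ^ 7 =
        deepFrame 2 ^ 7 * deepFrame 3 ^ 2 by ring]
    exact Ideal.mul_mem_left _ _ (Ideal.pow_mem_pow h3 2)

/-- **THE NODAL INHABITANT** [g21]: `z² + u·t·s + u⁵ ∈ 𝔽₂[z, u, t, s]` (variables `0, 1, 2, 3` = the frame `(z, u,
t, s)`): on `𝔸⁴_{𝔽₂}` its
top locus is EXACTLY `V(z,u,t) ∪ V(z,u,s)` (two regular branches, transversal in `V(z,u)`; `u⁵` kills the third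
branch `V(z,t,s)` of the
pure node), `τ = 1` at the origin ONLY, `τ = 3` elsewhere on the branches (instrument `explore/bl2.py`, NODE-g21
§3).  In no earlier leaf:
not Top-isolated, no second letter.  DEFINITION (support, the bed). [folklore] -/
noncomputable def nodalN : MvPolynomial (Fin 4) (ZMod 2) :=
  X 0 ^ 2 + X 1 * X 2 * X 3 + X 1 ^ 5

/-- The nodal inhabitant in node presentation: `ε = 1`, tail `u⁵`.  KERNEL (PROVED). [folklore] -/
theorem represent_nodalN : nodalN = deepFrame 0 ^ 2 + 1 * deepFrame 1 * deepFrame 2 * deepFrame 3 + deepFrame 1 ^ 5 := by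
  simp only [nodalN, deepFrame, Matrix.cons_val_zero, Matrix.cons_val_one, Matrix.head_cons, Matrix.cons_val_two,
    Matrix.tail_cons, Matrix.cons_val_three]
  ring

/-- **THE NODE LETTER HOLDS FOR THE NODAL INHABITANT AT THE RING LEVEL** [g21; KERNEL (PROVED)]: `ε = 1`, tail `u⁵ ∈ nodeWt c 7`
(`V₁ = V₂ = 5`, `ω = 10`), and the principal ideal lies in `nodeWt c 0`.  CERTIFICATE of the inhabitant's letter. [folklore] -/
theorem nodeShape_nodalN : NodeShape (Ideal.span {nodalN}) deepFrame := by
  have htail : deepFrame 1 ^ 5 ∈ nodeWt deepFrame 7 := by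
    have h := monomial_mem_nodeWt deepFrame 7 0 5 0 0 (by omega) (by omega) (by omega)
    simpa using h
  refine ⟨1, deepFrame 1 ^ 5, isUnit_one, htail, ?_, ?_⟩
  · rw [← represent_nodalN]
    exact Ideal.subset_span rfl
  · rw [Ideal.span_singleton_le_iff_mem, represent_nodalN]
    exact Ideal.add_mem _ (by simpa [mul_assoc] using node_terms_mem_nodeWt deepFrame 1) (nodeWt_anti deepFrame (by omega) htail)

end InhabitantKernel

end Summit.ResolutionOfSingularities.ResolutionOfSingularities.Theorems.DeepCrossCut
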